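import Summits.HodgeConjecture.CorCM.Hyp413.A3Liu413FaceTypes
import Summits.HodgeConjecture.HodgeConjecture.Theorems.HCCMUnconditionalH411
import Literature.NumberTheory.Automorphic.Liu2021.Prop413MultLeOneOfAsPrinted
import Summits.HodgeConjecture.HodgeConjecture.Theorems.F0P3SchurLine
import HarnessLib

/-!
# FLOOR-0 P3 «U3-mult», line `F0_U3CohMultOne` — SCHUR AT THE PIN (unconditional): `End_{U(V)(𝔸_{F⁺,f})}(ω_V(t)) = ℂ`, and the
# S3 ∕ S4 «one line» shape from a junction carrier

Cell hodgecm-mathlib, FLOOR 0; crux item H413 = stmt-HodgeConjecture-24833; line `Cruxes/H413/Lines/F0_U3CohMultOne.lean` v1.1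
(cf02d7697f46cc99, F0P3-plan (g0)); seat F0P3-p03 (JOIN-BRIEF §3 p03: «S3/S4 folds … the Schur step «`Hom_{G_f}(ω_V(t), Π_f)` is a line
for irreducible admissible `ω_V(t)`» … letter-independent»).  THEOREMS ONLY (no definition, no named fact, no `sorry`); nothing of
[Liu2021] ∕ [Rogawski1990] is asserted; HC_CM is proved only modulo the printed citations until rung 0 closes.

The registered stubs S3 ∕ S4 say: the `U(V)(𝔸_{F⁺,f})`-equivariant `ℂ`-linear maps `ψ : ω_V(t) → (U(V)(𝔸_{F⁺}) → ℂ²)` with values in the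
holomorphic (resp. antiholomorphic) cotangent forms lie on ONE LINE.  The generic algebra (the lift of such `ψ` to intertwiners
`ω_V(t) → τ` along an equivariant injection `j : τ → X`, and Schur's lemma in Hom-space form with the scalar commutant on the SOURCE)
is the sibling ★ `Theorems/F0P3SchurLine.lean`.  THIS file discharges the source-side input AT THE PIN,
with no hypothesis: for every face `(hDel, F, V, a₀, Φ, i)` and every admissible weight-one triple `t` of the printed datum
`P = datum413 hDel F V a₀ Φ i` (★ `CorCM/Hyp413/A3Liu413FaceTypes`), the summand `ω_V(t)` (`P.rhoAt t`) is irreducible-or-zero, smooth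
and admissible — [Liu2021, Def. 4.11] AS PRINTED, a THEOREM of the tree (the closed route item H411, ★ `Theorems.H411_proof`) — hence
`Representation.IsAdmissible` (★ `Liu2021.isAdmissible_of_isSmoothRep_of_isAdmissibleRep`); `U(V)(𝔸_{F⁺,f})` has the compact open
subgroup `(HodgeCM.Level.three V).K`; so Schur's lemma for irreducible admissible representations ([Bump1997, Prop. 4.2.4]; ★
`Representation.IsAdmissible.exists_eq_smul_id`) gives `End_{G_f}(ω_V(t)) = ℂ · id` whenever `ω_V(t) ≠ 0`
(`scalar_of_comm_rhoAt_datum413`).  Consequences, all hypothesis-free: `rank_ℂ Hom_{G_f}(ω_V(t), τ) ≤ 1` for `τ` irreducible-or-zero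
(`rank_intertwiningMap_rhoAt_datum413_le_one_of_irreducible`) or `G_f`-isomorphic to a direct sum of pairwise non-isomorphic
irreducible-or-zero representations (`…_of_directSum`, the Matsushima shape — NO admissibility asked of the summands `Π_f`); and the
S3 ∕ S4-SHAPED conclusions for ANY representation `R` on ANY `X` and ANY `A ≤ X` — the equivariant `A`-valued maps out of `ω_V(t)` lie
on a line as soon as they factor through an equivariant injection from such a carrier `τ` (`exists_line_rhoAt_datum413_of_rank_carrier`
∕ `…_of_irreducible_carrier` ∕ `…_of_directSum_carrier`).  The folds of the registered S3 ∕ S4 (`R = rightRep F V`, `A = holCotForms 𝔞₀` ∕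
`conj holCotForms 𝔞₀`) are the sibling `Theorems/F0P3HolLineFolds.lean`; producing the carrier is the junction T7 + the engine letter E1′
(`Rogawski1990/CohomologicalSpectrumInnerForm.cohFinComponentUnique_hol ∕ _antihol`), not this file.

## References
* [Bump1997] D. Bump, *Automorphic Forms and Representations*, CUP 1997 — Prop. 4.2.4.
* [Liu2021] Y. Liu, Camb. J. Math. 9 (2021) — Def. 4.11 (FJcycle.tex ll. 2083–2097); proof of Prop. 4.13, ll. 2131–2146.
* [BorelWallach2000] A. Borel, N. Wallach, 2nd ed. (2000) — VII 3.2 (Matsushima; the shape of the direct-sum carrier).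
* [Rogawski1990] J. Rogawski, Ann. of Math. Stud. 123 — Thm. 14.6.4, §15.3 (the engine behind the carrier; not used here).
* Tree: ★ `Theorems/HCCMUnconditionalH411.lean` (`Theorems.H411_proof`), ★ `Liu2021/Prop413MultLeOneOfAsPrinted.lean`
  (`isAdmissible_of_isSmoothRep_of_isAdmissibleRep`, `isIrreducible_of_isIrreducibleOrZero`), ★
  `Automorphic/RestrictedTensorProductIrreducibleProofs.lean` (`Representation.IsAdmissible.exists_eq_smul_id`), ★
  `Theorems/F0P3SchurLine.lean` (generic Schur line lemma), `HodgeCM/CM/Basic.lean` (`Level.three`).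
-/

set_option autoImplicit false

-- the mandated namespace has the single-problem summit's repeated segment (`HodgeConjecture.HodgeConjecture`)
set_option linter.dupNamespace false

noncomputable section

namespace Summit.HodgeConjecture.HodgeConjecture.Cruxes.H413.F0P3SchurLineAtPin

open scoped DirectSum
open Summit.HodgeConjecture.HodgeConjecture.Cruxes.H413.F0P3SchurLine

/-! ## Schur for `ω_V(t)` at the pin, unconditionally ([Liu2021, Def. 4.11] AS PRINTED = ★ `Theorems.H411_proof`) -/

section Pin

open NumberField
open HodgeCM.Model HodgeCM.Model.LiuIndex
open Literature.AlgebraicGeometry.Motives (CMType)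
open Literature.NumberTheory.Automorphic.Liu2021
open Summit.HodgeConjecture.CorCM.Lines.A3Liu413 (datum413)

universe uX uY uH uι uS

set_option synthInstance.maxHeartbeats 400000 in
set_option maxHeartbeats 8000000 in
/-- **[Liu2021, Def. 4.11] AS PRINTED at the pin's summands — a THEOREM of the tree.**  For every face `(hDel, F, V, a₀, Φ, i)` and
every admissible weight-one triple `t` of `P = datum413 hDel F V a₀ Φ i`, the summand `ω_V(t)` (`P.rhoAt t`) is irreducible-or-zero,
smooth and admissible: the CLOSED route item `HCCMUnconditional.H411` (★ `Theorems.H411_proof` — Def. 4.11 at the δ′-rest of the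
real scalar `repAt a₀ i.1`) read at `(t.μ, t.ε, t.χ)`; that rest's `rho ε χ` IS `P.rhoAt t` (★ `Model.restOfCharRep_eq_rest`, `rfl`).
[cite: Liu2021, Def. 4.11 (FJcycle.tex ll. 2083–2097)] -/
theorem adjectives_rhoAt_datum413
    (hDel : Literature.AlgebraicGeometry.ShimuraVarieties.UnitaryCanonicalModel.canonicalModel_exists_printed)
    (F : HodgeCM.CMField) [IsGalois ℚ F] (h6 : 6 ≤ Module.finrank ℚ F) {ι₁ : F →+* ℂ} (V : HodgeCM.HermSpace3 F ι₁)
    (a₀ : RealScalar F) (Φ : CMType F) (hΦ : ι₁ ∈ Φ.1) (i : (I V (repAt a₀) (muLiu ι₁ GramClass.rep)))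
    (t : (datum413 hDel F V a₀ Φ i).AdmTriple) :
    IsIrreducibleOrZero ((datum413 hDel F V a₀ Φ i).rhoAt t) ∧ IsSmoothRep ((datum413 hDel F V a₀ Φ i).rhoAt t) ∧
      IsAdmissibleRep ((datum413 hDel F V a₀ Φ i).rhoAt t) :=
  Summit.HodgeConjecture.HodgeConjecture.Theorems.H411_proof hDel F h6 V (repAt a₀ (Sigma.fst i)) Φ hΦ t.1.μ
    t.1.isConjugateSymplectic t.2.1 t.1.ε t.1.χ

set_option synthInstance.maxHeartbeats 400000 in
set_option maxHeartbeats 8000000 in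
/-- `ω_V(t)` at the pin is ADMISSIBLE in the tree's sense (`Representation.IsAdmissible`: open stabilisers, finite-dimensional fixed
vectors under compact open subgroups) — Def. 4.11's two adjectives through ★ `Liu2021.isAdmissible_of_isSmoothRep_of_isAdmissibleRep`.
[cite: Liu2021, Def. 4.11 (ll. 2092–2096)] -/
theorem isAdmissible_rhoAt_datum413
    (hDel : Literature.AlgebraicGeometry.ShimuraVarieties.UnitaryCanonicalModel.canonicalModel_exists_printed)
    (F : HodgeCM.CMField) [IsGalois ℚ F] (h6 : 6 ≤ Module.finrank ℚ F) {ι₁ : F →+* ℂ} (V : HodgeCM.HermSpace3 F ι₁)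
    (a₀ : RealScalar F) (Φ : CMType F) (hΦ : ι₁ ∈ Φ.1) (i : (I V (repAt a₀) (muLiu ι₁ GramClass.rep)))
    (t : (datum413 hDel F V a₀ Φ i).AdmTriple) :
    ((datum413 hDel F V a₀ Φ i).rhoAt t).IsAdmissible :=
  isAdmissible_of_isSmoothRep_of_isAdmissibleRep (adjectives_rhoAt_datum413 hDel F h6 V a₀ Φ hΦ i t).2.1
    (adjectives_rhoAt_datum413 hDel F h6 V a₀ Φ hΦ i t).2.2

set_option synthInstance.maxHeartbeats 400000 in
set_option maxHeartbeats 8000000 in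
/-- A NON-ZERO `ω_V(t)` at the pin is irreducible (Mathlib `Representation.IsIrreducible`). [cite: Liu2021, Def. 4.11 (ll. 2092–2096)] -/
theorem isIrreducible_rhoAt_datum413
    (hDel : Literature.AlgebraicGeometry.ShimuraVarieties.UnitaryCanonicalModel.canonicalModel_exists_printed)
    (F : HodgeCM.CMField) [IsGalois ℚ F] (h6 : 6 ≤ Module.finrank ℚ F) {ι₁ : F →+* ℂ} (V : HodgeCM.HermSpace3 F ι₁)
    (a₀ : RealScalar F) (Φ : CMType F) (hΦ : ι₁ ∈ Φ.1) (i : (I V (repAt a₀) (muLiu ι₁ GramClass.rep)))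
    (t : (datum413 hDel F V a₀ Φ i).AdmTriple) (hW : Nontrivial ((datum413 hDel F V a₀ Φ i).omegaAt t)) :
    ((datum413 hDel F V a₀ Φ i).rhoAt t).IsIrreducible :=
  isIrreducible_of_isIrreducibleOrZero (adjectives_rhoAt_datum413 hDel F h6 V a₀ Φ hΦ i t).1 hW

set_option synthInstance.maxHeartbeats 400000 in
set_option maxHeartbeats 8000000 in
/-- **SCHUR AT THE PIN (unconditional): `End_{U(V)(𝔸_{F⁺,f})}(ω_V(t)) = ℂ · id`.**  For every face, every admissible weight-one `t`
with `ω_V(t) ≠ 0`, every `ℂ`-linear `T : ω_V(t) → ω_V(t)` commuting with the action is a scalar — Schur's lemma for irreducible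
ADMISSIBLE representations ([Bump1997, Prop. 4.2.4]; ★ `Representation.IsAdmissible.exists_eq_smul_id`) at the compact open level
subgroup `(HodgeCM.Level.three V).K ≤ U(V)(𝔸_{F⁺,f})`, admissibility and irreducibility being [Liu2021, Def. 4.11] (★ `Theorems.H411_proof`).
[cite: Bump1997, Proposition 4.2.4] [cite: Liu2021, Def. 4.11 (ll. 2092–2096)] -/
theorem scalar_of_comm_rhoAt_datum413
    (hDel : Literature.AlgebraicGeometry.ShimuraVarieties.UnitaryCanonicalModel.canonicalModel_exists_printed)
    (F : HodgeCM.CMField) [IsGalois ℚ F] (h6 : 6 ≤ Module.finrank ℚ F) {ι₁ : F →+* ℂ} (V : HodgeCM.HermSpace3 F ι₁)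
    (a₀ : RealScalar F) (Φ : CMType F) (hΦ : ι₁ ∈ Φ.1) (i : (I V (repAt a₀) (muLiu ι₁ GramClass.rep)))
    (t : (datum413 hDel F V a₀ Φ i).AdmTriple) (hW : Nontrivial ((datum413 hDel F V a₀ Φ i).omegaAt t))
    (T : (datum413 hDel F V a₀ Φ i).omegaAt t →ₗ[ℂ] (datum413 hDel F V a₀ Φ i).omegaAt t)
    (hT : ∀ g, T ∘ₗ (datum413 hDel F V a₀ Φ i).rhoAt t g = (datum413 hDel F V a₀ Φ i).rhoAt t g ∘ₗ T) :
    ∃ c : ℂ, T = c • LinearMap.id := by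
  haveI := isIrreducible_rhoAt_datum413 hDel F h6 V a₀ Φ hΦ i t hW
  exact (isAdmissible_rhoAt_datum413 hDel F h6 V a₀ Φ hΦ i t).exists_eq_smul_id (K := (HodgeCM.Level.three V).K)
    (HodgeCM.Level.three V).isOpen_K (HodgeCM.Level.three V).isCompact_K T hT

set_option synthInstance.maxHeartbeats 400000 in
set_option maxHeartbeats 8000000 in
/-- **`rank_ℂ Hom_{G_f}(ω_V(t), τ) ≤ 1` for every irreducible-or-zero `τ`**, hypothesis-free at the pin (Schur at the pin if
`ω_V(t) ≠ 0`, trivial if `ω_V(t) = 0`). [cite: Bump1997, Proposition 4.2.4] [cite: Liu2021, proof of Prop. 4.13, l. 2145] -/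
theorem rank_intertwiningMap_rhoAt_datum413_le_one_of_irreducible
    (hDel : Literature.AlgebraicGeometry.ShimuraVarieties.UnitaryCanonicalModel.canonicalModel_exists_printed)
    (F : HodgeCM.CMField) [IsGalois ℚ F] (h6 : 6 ≤ Module.finrank ℚ F) {ι₁ : F →+* ℂ} (V : HodgeCM.HermSpace3 F ι₁)
    (a₀ : RealScalar F) (Φ : CMType F) (hΦ : ι₁ ∈ Φ.1) (i : (I V (repAt a₀) (muLiu ι₁ GramClass.rep)))
    (t : (datum413 hDel F V a₀ Φ i).AdmTriple) {Y : Type uY} [AddCommGroup Y] [Module ℂ Y]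
    (τ : Representation ℂ ↥(HodgeCM.HermSpace3.adelicFin V) Y) (hirr : Nontrivial Y → τ.IsIrreducible) :
    Module.rank ℂ (((datum413 hDel F V a₀ Φ i).rhoAt t).IntertwiningMap τ) ≤ 1 := by
  by_cases hW : Nontrivial ((datum413 hDel F V a₀ Φ i).omegaAt t)
  · haveI := isIrreducible_rhoAt_datum413 hDel F h6 V a₀ Φ hΦ i t hW
    exact rank_intertwiningMap_le_one_of_scalar_comm (scalar_of_comm_rhoAt_datum413 hDel F h6 V a₀ Φ hΦ i t hW) hirr
  · haveI : Subsingleton ((datum413 hDel F V a₀ Φ i).omegaAt t) := not_nontrivial_iff_subsingleton.mp hW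
    exact rank_intertwiningMap_le_one_of_subsingleton _ _

set_option synthInstance.maxHeartbeats 400000 in
set_option maxHeartbeats 8000000 in
/-- **`rank_ℂ Hom_{G_f}(ω_V(t), τ) ≤ 1` for every `τ` that is `G_f`-equivariantly a direct sum of pairwise non-isomorphic
irreducible-or-zero representations** (the Matsushima shape `⨁_Π Π_f`, [BorelWallach2000, VII 3.2]; pairwise non-isomorphy of the
`Π_f` among the `Π` of one Hodge type is the engine letter E1′), hypothesis-free at the pin; NO admissibility is asked of the summands.
[cite: Bump1997, Proposition 4.2.4] [cite: Liu2021, proof of Prop. 4.13, l. 2145] [cite: BorelWallach2000, VII 3.2] -/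
theorem rank_intertwiningMap_rhoAt_datum413_le_one_of_directSum
    (hDel : Literature.AlgebraicGeometry.ShimuraVarieties.UnitaryCanonicalModel.canonicalModel_exists_printed)
    (F : HodgeCM.CMField) [IsGalois ℚ F] (h6 : 6 ≤ Module.finrank ℚ F) {ι₁ : F →+* ℂ} (V : HodgeCM.HermSpace3 F ι₁)
    (a₀ : RealScalar F) (Φ : CMType F) (hΦ : ι₁ ∈ Φ.1) (i : (I V (repAt a₀) (muLiu ι₁ GramClass.rep)))
    (t : (datum413 hDel F V a₀ Φ i).AdmTriple) {H : Type uH} [AddCommGroup H] [Module ℂ H]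
    (τ : Representation ℂ ↥(HodgeCM.HermSpace3.adelicFin V) H) {ι : Type uι} {S : ι → Type uS} [∀ i, AddCommGroup (S i)]
    [∀ i, Module ℂ (S i)] (σ : ∀ i, Representation ℂ ↥(HodgeCM.HermSpace3.adelicFin V) (S i)) (Ψ : H ≃ₗ[ℂ] ⨁ i, S i)
    (hΨ : ∀ (g : ↥(HodgeCM.HermSpace3.adelicFin V)) (x : H) (i : ι), Ψ (τ g x) i = σ i g (Ψ x i))
    (hirr : ∀ i, Nontrivial (S i) → (σ i).IsIrreducible) (hsep : ∀ i j, Nontrivial (S i) → Nonempty ((σ i).Equiv (σ j)) → i = j) :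
    Module.rank ℂ (((datum413 hDel F V a₀ Φ i).rhoAt t).IntertwiningMap τ) ≤ 1 := by
  by_cases hW : Nontrivial ((datum413 hDel F V a₀ Φ i).omegaAt t)
  · haveI := isIrreducible_rhoAt_datum413 hDel F h6 V a₀ Φ hΦ i t hW
    exact rank_intertwiningMap_le_one_of_scalar_comm_of_directSum (scalar_of_comm_rhoAt_datum413 hDel F h6 V a₀ Φ hΦ i t hW)
      Ψ hΨ hirr hsep
  · haveI : Subsingleton ((datum413 hDel F V a₀ Φ i).omegaAt t) := not_nontrivial_iff_subsingleton.mp hW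
    exact rank_intertwiningMap_le_one_of_subsingleton _ _

set_option synthInstance.maxHeartbeats 400000 in
set_option maxHeartbeats 8000000 in
/-- **THE S3 ∕ S4 SHAPE at the pin, RANK SOCKET.**  For ANY representation `R` of `U(V)(𝔸_{F⁺,f})` on ANY `X` and ANY `A ≤ X`: if the
equivariant `A`-valued linear maps out of `ω_V(t)` take values in the range of an equivariant injection `j : τ → X` with
`rank_ℂ Hom_{G_f}(ω_V(t), τ) ≤ 1`, they lie on one line.  (The registered S3 ∕ S4 are the instances `R = rightRep F V`,
`A = holCotForms 𝔞₀` ∕ `conj holCotForms 𝔞₀`; the carrier `τ` is the junction's.) [cite: Liu2021, proof of Prop. 4.13, l. 2131–2146] -/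
theorem exists_line_rhoAt_datum413_of_rank_carrier
    (hDel : Literature.AlgebraicGeometry.ShimuraVarieties.UnitaryCanonicalModel.canonicalModel_exists_printed)
    (F : HodgeCM.CMField) [IsGalois ℚ F] {ι₁ : F →+* ℂ} (V : HodgeCM.HermSpace3 F ι₁)
    (a₀ : RealScalar F) (Φ : CMType F) (i : (I V (repAt a₀) (muLiu ι₁ GramClass.rep)))
    (t : (datum413 hDel F V a₀ Φ i).AdmTriple) {X : Type uX} [AddCommGroup X] [Module ℂ X]
    (R : Representation ℂ ↥(HodgeCM.HermSpace3.adelicFin V) X) (A : Submodule ℂ X) {Y : Type uY} [AddCommGroup Y] [Module ℂ Y]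
    (τ : Representation ℂ ↥(HodgeCM.HermSpace3.adelicFin V) Y) (j : Y →ₗ[ℂ] X) (hj : Function.Injective j)
    (hjeqv : ∀ (g : ↥(HodgeCM.HermSpace3.adelicFin V)) (y : Y), j (τ g y) = R g (j y))
    (hA : ∀ ψ : (datum413 hDel F V a₀ Φ i).omegaAt t →ₗ[ℂ] X,
      (∀ (g : ↥(HodgeCM.HermSpace3.adelicFin V)) (w : (datum413 hDel F V a₀ Φ i).omegaAt t),
          ψ ((datum413 hDel F V a₀ Φ i).rhoAt t g w) = R g (ψ w)) → (∀ w, ψ w ∈ A) → ∀ w, ψ w ∈ LinearMap.range j)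
    (hrank : Module.rank ℂ (((datum413 hDel F V a₀ Φ i).rhoAt t).IntertwiningMap τ) ≤ 1) :
    ∃ ψ₀ : (datum413 hDel F V a₀ Φ i).omegaAt t →ₗ[ℂ] X, ∀ ψ : (datum413 hDel F V a₀ Φ i).omegaAt t →ₗ[ℂ] X,
      (∀ (g : ↥(HodgeCM.HermSpace3.adelicFin V)) (w : (datum413 hDel F V a₀ Φ i).omegaAt t),
          ψ ((datum413 hDel F V a₀ Φ i).rhoAt t g w) = R g (ψ w)) → (∀ w, ψ w ∈ A) → ∃ r : ℂ, ψ = r • ψ₀ :=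
  exists_line_of_rank_intertwiningMap_le_one ((datum413 hDel F V a₀ Φ i).rhoAt t) R A τ j hj hjeqv hA hrank

set_option synthInstance.maxHeartbeats 400000 in
set_option maxHeartbeats 8000000 in
/-- **THE S3 ∕ S4 SHAPE at the pin, IRREDUCIBLE-CARRIER SOCKET (hypothesis-free Schur).**  If the equivariant `A`-valued maps out of
`ω_V(t)` take values in the range of an equivariant injection from ONE irreducible-or-zero `τ` (after E1′: the `(1,0)`-part of the
unique discrete `Π` of that Hodge type with `Π_f ≅ ω_V(t)`), they lie on one line. [cite: Bump1997, Proposition 4.2.4]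
[cite: Liu2021, proof of Prop. 4.13, l. 2131–2146] [cite: Rogawski1990, Thm. 14.6.4] -/
theorem exists_line_rhoAt_datum413_of_irreducible_carrier
    (hDel : Literature.AlgebraicGeometry.ShimuraVarieties.UnitaryCanonicalModel.canonicalModel_exists_printed)
    (F : HodgeCM.CMField) [IsGalois ℚ F] (h6 : 6 ≤ Module.finrank ℚ F) {ι₁ : F →+* ℂ} (V : HodgeCM.HermSpace3 F ι₁)
    (a₀ : RealScalar F) (Φ : CMType F) (hΦ : ι₁ ∈ Φ.1) (i : (I V (repAt a₀) (muLiu ι₁ GramClass.rep)))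
    (t : (datum413 hDel F V a₀ Φ i).AdmTriple) {X : Type uX} [AddCommGroup X] [Module ℂ X]
    (R : Representation ℂ ↥(HodgeCM.HermSpace3.adelicFin V) X) (A : Submodule ℂ X) {Y : Type uY} [AddCommGroup Y] [Module ℂ Y]
    (τ : Representation ℂ ↥(HodgeCM.HermSpace3.adelicFin V) Y) (hirr : Nontrivial Y → τ.IsIrreducible)
    (j : Y →ₗ[ℂ] X) (hj : Function.Injective j)
    (hjeqv : ∀ (g : ↥(HodgeCM.HermSpace3.adelicFin V)) (y : Y), j (τ g y) = R g (j y))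
    (hA : ∀ ψ : (datum413 hDel F V a₀ Φ i).omegaAt t →ₗ[ℂ] X,
      (∀ (g : ↥(HodgeCM.HermSpace3.adelicFin V)) (w : (datum413 hDel F V a₀ Φ i).omegaAt t),
          ψ ((datum413 hDel F V a₀ Φ i).rhoAt t g w) = R g (ψ w)) → (∀ w, ψ w ∈ A) → ∀ w, ψ w ∈ LinearMap.range j) :
    ∃ ψ₀ : (datum413 hDel F V a₀ Φ i).omegaAt t →ₗ[ℂ] X, ∀ ψ : (datum413 hDel F V a₀ Φ i).omegaAt t →ₗ[ℂ] X,
      (∀ (g : ↥(HodgeCM.HermSpace3.adelicFin V)) (w : (datum413 hDel F V a₀ Φ i).omegaAt t),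
          ψ ((datum413 hDel F V a₀ Φ i).rhoAt t g w) = R g (ψ w)) → (∀ w, ψ w ∈ A) → ∃ r : ℂ, ψ = r • ψ₀ :=
  exists_line_of_rank_intertwiningMap_le_one ((datum413 hDel F V a₀ Φ i).rhoAt t) R A τ j hj hjeqv hA
    (rank_intertwiningMap_rhoAt_datum413_le_one_of_irreducible hDel F h6 V a₀ Φ hΦ i t τ hirr)

set_option synthInstance.maxHeartbeats 400000 in
set_option maxHeartbeats 8000000 in
/-- **THE S3 ∕ S4 SHAPE at the pin, MATSUSHIMA (direct-sum) SOCKET (hypothesis-free Schur).**  If the equivariant `A`-valued maps out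
of `ω_V(t)` take values in the range of an equivariant injection from a `τ ≅ ⨁ i, σ i` with the `σ i` irreducible-or-zero and pairwise
non-isomorphic (the `(1,0)`-forms `≅ ⨁_Π H^{1,0}-line ⊗ Π_f`, [BorelWallach2000, VII 3.2] + E1′), they lie on one line.
[cite: Bump1997, Proposition 4.2.4] [cite: BorelWallach2000, VII 3.2] [cite: Liu2021, proof of Prop. 4.13, l. 2131–2146] -/
theorem exists_line_rhoAt_datum413_of_directSum_carrier
    (hDel : Literature.AlgebraicGeometry.ShimuraVarieties.UnitaryCanonicalModel.canonicalModel_exists_printed)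
    (F : HodgeCM.CMField) [IsGalois ℚ F] (h6 : 6 ≤ Module.finrank ℚ F) {ι₁ : F →+* ℂ} (V : HodgeCM.HermSpace3 F ι₁)
    (a₀ : RealScalar F) (Φ : CMType F) (hΦ : ι₁ ∈ Φ.1) (i : (I V (repAt a₀) (muLiu ι₁ GramClass.rep)))
    (t : (datum413 hDel F V a₀ Φ i).AdmTriple) {X : Type uX} [AddCommGroup X] [Module ℂ X]
    (R : Representation ℂ ↥(HodgeCM.HermSpace3.adelicFin V) X) (A : Submodule ℂ X) {H : Type uH} [AddCommGroup H] [Module ℂ H]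
    (τ : Representation ℂ ↥(HodgeCM.HermSpace3.adelicFin V) H) {ι : Type uι} {S : ι → Type uS} [∀ i, AddCommGroup (S i)]
    [∀ i, Module ℂ (S i)] (σ : ∀ i, Representation ℂ ↥(HodgeCM.HermSpace3.adelicFin V) (S i)) (Ψ : H ≃ₗ[ℂ] ⨁ i, S i)
    (hΨ : ∀ (g : ↥(HodgeCM.HermSpace3.adelicFin V)) (x : H) (i : ι), Ψ (τ g x) i = σ i g (Ψ x i))
    (hirr : ∀ i, Nontrivial (S i) → (σ i).IsIrreducible) (hsep : ∀ i j, Nontrivial (S i) → Nonempty ((σ i).Equiv (σ j)) → i = j)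
    (j : H →ₗ[ℂ] X) (hj : Function.Injective j)
    (hjeqv : ∀ (g : ↥(HodgeCM.HermSpace3.adelicFin V)) (y : H), j (τ g y) = R g (j y))
    (hA : ∀ ψ : (datum413 hDel F V a₀ Φ i).omegaAt t →ₗ[ℂ] X,
      (∀ (g : ↥(HodgeCM.HermSpace3.adelicFin V)) (w : (datum413 hDel F V a₀ Φ i).omegaAt t),
          ψ ((datum413 hDel F V a₀ Φ i).rhoAt t g w) = R g (ψ w)) → (∀ w, ψ w ∈ A) → ∀ w, ψ w ∈ LinearMap.range j) :
    ∃ ψ₀ : (datum413 hDel F V a₀ Φ i).omegaAt t →ₗ[ℂ] X, ∀ ψ : (datum413 hDel F V a₀ Φ i).omegaAt t →ₗ[ℂ] X,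
      (∀ (g : ↥(HodgeCM.HermSpace3.adelicFin V)) (w : (datum413 hDel F V a₀ Φ i).omegaAt t),
          ψ ((datum413 hDel F V a₀ Φ i).rhoAt t g w) = R g (ψ w)) → (∀ w, ψ w ∈ A) → ∃ r : ℂ, ψ = r • ψ₀ :=
  exists_line_of_rank_intertwiningMap_le_one ((datum413 hDel F V a₀ Φ i).rhoAt t) R A τ j hj hjeqv hA
    (rank_intertwiningMap_rhoAt_datum413_le_one_of_directSum hDel F h6 V a₀ Φ hΦ i t τ σ Ψ hΨ hirr hsep)

end Pin

end Summit.HodgeConjecture.HodgeConjecture.Cruxes.H413.F0P3SchurLineAtPin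

end
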